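import Summits.CriticalPhenomena.PercolationContinuityZ3.Theorems.Transplant.BccClawXLegs
import Summits.CriticalPhenomena.PercolationContinuityZ3.Theorems.Transplant.BccSlabLift
import Summits.CriticalPhenomena.PercolationContinuityZ3.Theorems.Transplant.VPathKit
import HarnessLib

/-!
# The bcc (001)-slabs, exit-form routing certificate V: THE 3D HUB TEMPLATE — a swap pair of routings from a planar claw (every `k ≥ 3`)

builds on p205010 (kernel theorem, internal audit signed; external expert review pending) — NOT used in this file.
Lane `prim-bschramm`, seat `prim-bschramm-p2` (gen 46; class C1b, METHOD = input substitution; memo `HOME/bschramm/P2-LATTICES.md` §156); helper file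
(`--supports stmt-CriticalPhenomena-4575 --as helper`).
* §1 **`VRouteData.swapPair_of_hub`** (pure graph theory, any graph): three pairwise disjoint self-avoiding legs `A : c ⇝ E₁`, `B : m ⇝ E₂` (in `W_R`),
  `C : n ⇝ w'` (in `W`) and two hub vertices `y ≠ b ∈ W_R` off the legs, both adjacent to `c, m, n`, give the two routings `(A⁻¹·y·B, c → y, b·C)` and
  `(A⁻¹·b·B, c → b, y·C)` («VPathKit».`VRouteData.ofPaths`) — a SWAP PAIR;
* §2 **`BccSlab.exists_lift'`**: «BccSlabLift».`exists_lift` sharpened — with `≥ 3` planar columns the lift visits the last column only at its end vertex;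
* §3 **`BccSlab.swapPair_of_clawProps`** (`k ≥ 3`): from a planar claw of the model («BccClawXSound».`ClawProps`, relative to `z`, for the columns of
  `E₁, E₂, w'`) — hub column `Q`, hub vertices `(Q, h₀)`, `(Q, h₀+2)` (`h₀ ∈ {0,1}` by parity; `k ≥ 3`), ports at height `h₀+1` over the legs' first columns,
  legs lifted by §2 — to a swap pair of `VRouteData` for the cleared sets of «BccSlabClearedSetX» (column-disjointness ⇒ vertex-disjointness; when `a₁ = a₂`
  the two lifted legs meet the shared column only at `E₁ ≠ E₂`).
[cite: DuminilCopinSidoraviciusTassion2016, §2.3 (proof of Fact 2: the three disjoint paths γ_u, γ_v, γ_w in B̄_R(z))]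
-/

noncomputable section

namespace Summit.CriticalPhenomena.PercolationContinuityZ3.Theorems.Transplant

/-! ## §1 A swap pair from a hub (pure graph theory) -/

namespace VRouteData

open SimpleGraph

variable {V : Type} {G : SimpleGraph V} {WR W : Set V}

/-- Membership in `tail.dropLast` implies membership. [folklore] -/
theorem mem_of_mem_tail_dropLast {l : List V} {x : V} (h : x ∈ l.tail.dropLast) : x ∈ l :=
  List.tail_subset l (List.dropLast_subset _ h)

/-- **One routing from a hub**: legs `A : c ⇝ E₁`, `B : m ⇝ E₂` (inside `W_R`), `C : n ⇝ w'` (inside `W`), pairwise disjoint, and two vertices `u ∈ W_R`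
(put on the chain between `c` and `m`) and `v ∈ W` (first branch vertex, between `c` and `n`) off the legs: the rerouted chain `A⁻¹ · u · B` with the
marked edge `c → u` and the branch `v · C`. [cite: DuminilCopinSidoraviciusTassion2016, §2.3 (proof of Fact 2: γ_u, γ_v, γ_w)] -/
theorem exists_of_hub {E₁ E₂ w' c m n u v : V} {LA LB LC : List V} (hA : GPath G LA c E₁) (hB : GPath G LB m E₂) (hC : GPath G LC n w')
    (hne : E₁ ≠ E₂) (hAW : ∀ x ∈ LA, x ∈ WR) (hBW : ∀ x ∈ LB, x ∈ WR) (hCW : ∀ x ∈ LC, x ∈ W) (huW : u ∈ WR) (hvW : v ∈ W)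
    (hcu : G.Adj c u) (hcv : G.Adj c v) (hum : G.Adj u m) (hvn : G.Adj v n) (huv : u ≠ v)
    (hAB : ∀ x ∈ LA, x ∉ LB) (hAC : ∀ x ∈ LA, x ∉ LC) (hBC : ∀ x ∈ LB, x ∉ LC)
    (huA : u ∉ LA) (huB : u ∉ LB) (huC : u ∉ LC) (hvA : v ∉ LA) (hvB : v ∉ LB) (hvC : v ∉ LC) :
    ∃ r : VRouteData G WR W E₁ E₂ w', r.y = u ∧ r.b = v := by
  -- the chain `A⁻¹ ++ u :: B`
  have hcA : c ∈ LA := hA.head_mem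
  have huB' : GPath G (u :: LB) u E₂ := hB.cons hum huB
  have hcuB : GPath G (c :: u :: LB) c E₂ := by
    refine huB'.cons hcu ?_
    intro h
    rcases List.mem_cons.1 h with h | h
    · exact huA (h ▸ hcA)
    · exact hAB c hcA h
  have hSP : GPath G (LA.reverse ++ (u :: LB)) E₁ E₂ := by
    have := hA.reverse.trans hcuB ?_
    · simpa using this
    · intro x hx hxA
      rw [List.mem_reverse] at hxA
      rcases List.mem_cons.1 hx with rfl | hx
      · rfl
      · rcases List.mem_cons.1 hx with rfl | hx
        · exact absurd hxA huA
        · exact absurd hx (hAB x hxA)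
  have hint : ∀ x ∈ (LA.reverse ++ (u :: LB)).tail.dropLast, x ∈ WR := by
    intro x hx
    have hx' := mem_of_mem_tail_dropLast hx
    rcases List.mem_append.1 hx' with h | h
    · exact hAW x (List.mem_reverse.1 h)
    · rcases List.mem_cons.1 h with rfl | h
      · exact huW
      · exact hBW x h
  have hcy : ∃ l₁ l₂ : List V, LA.reverse ++ (u :: LB) = l₁ ++ c :: u :: l₂ := by
    refine ⟨LA.reverse.dropLast, LB, ?_⟩
    have hne' : LA.reverse ≠ [] := by simpa using hA.ne_nil
    have hlast : LA.reverse.getLast hne' = c := by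
      rw [List.getLast_reverse]; exact (List.head_eq_iff_head?_eq_some _).2 hA.head
    conv_lhs => rw [← List.dropLast_append_getLast hne', hlast]
    simp
  -- the branch `v :: C`
  have hBr : GPath G (v :: LC) v w' := hC.cons hvn hvC
  have hBrW : ∀ x ∈ v :: LC, x ∈ W := by
    intro x hx
    rcases List.mem_cons.1 hx with rfl | hx
    · exact hvW
    · exact hCW x hx
  have hoff : ∀ x ∈ v :: LC, x ∉ LA.reverse ++ (u :: LB) := by
    intro x hx hmem
    rcases List.mem_append.1 hmem with h | h
    · rw [List.mem_reverse] at h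
      rcases List.mem_cons.1 hx with rfl | hx
      · exact hvA h
      · exact hAC x h hx
    · rcases List.mem_cons.1 h with rfl | h
      · rcases List.mem_cons.1 hx with h' | hx
        · exact huv h'
        · exact huC hx
      · rcases List.mem_cons.1 hx with rfl | hx
        · exact hvB h
        · exact hBC x h hx
  exact ⟨ofPaths hSP hne hint hcy hBr hBrW hcv hoff, ofPaths_y _ _ _ _ _ _ _ _, ofPaths_b _ _ _ _ _ _ _ _⟩

/-- **A SWAP PAIR FROM A HUB**: legs `A : c ⇝ E₁`, `B : m ⇝ E₂` in `W_R`, `C : n ⇝ w'` in `W`, pairwise disjoint, and two hub vertices `y ≠ b` in `W_R` off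
the legs, BOTH adjacent to all of `c, m, n`: the routings `(A⁻¹·y·B, c → y, branch b·C)` and `(A⁻¹·b·B, c → b, branch y·C)` have the successor of the
attachment vertex and the first branch vertex exchanged. [cite: DuminilCopinSidoraviciusTassion2016, §2.3 (proof of Fact 2)] -/
theorem swapPair_of_hub {E₁ E₂ w' c m n y b : V} {LA LB LC : List V} (hA : GPath G LA c E₁) (hB : GPath G LB m E₂) (hC : GPath G LC n w')
    (hne : E₁ ≠ E₂) (hAW : ∀ x ∈ LA, x ∈ WR) (hBW : ∀ x ∈ LB, x ∈ WR) (hCW : ∀ x ∈ LC, x ∈ W) (hyW : y ∈ WR) (hbW : b ∈ WR) (hWRW : WR ⊆ W)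
    (hcy : G.Adj c y) (hcb : G.Adj c b) (hym : G.Adj y m) (hbm : G.Adj b m) (hyn : G.Adj y n) (hbn : G.Adj b n) (hyb : y ≠ b)
    (hAB : ∀ x ∈ LA, x ∉ LB) (hAC : ∀ x ∈ LA, x ∉ LC) (hBC : ∀ x ∈ LB, x ∉ LC)
    (hyA : y ∉ LA) (hyB : y ∉ LB) (hyC : y ∉ LC) (hbA : b ∉ LA) (hbB : b ∉ LB) (hbC : b ∉ LC) :
    ∃ r₁ r₂ : VRouteData G WR W E₁ E₂ w', r₁.y = r₂.b ∧ r₁.b = r₂.y := by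
  obtain ⟨r₁, h1y, h1b⟩ := exists_of_hub hA hB hC hne hAW hBW hCW hyW (hWRW hbW) hcy hcb hym hbn hyb hAB hAC hBC hyA hyB hyC hbA hbB hbC
  obtain ⟨r₂, h2y, h2b⟩ := exists_of_hub hA hB hC hne hAW hBW hCW hbW (hWRW hyW) hcb hcy hbm hyn hyb.symm hAB hAC hBC hbA hbB hbC hyA hyB hyC
  exact ⟨r₁, r₂, by rw [h1y, h2b], by rw [h1b, h2y]⟩

end VRouteData

/-! ## §2 Lifting a planar leg with the last column visited once -/

namespace BccSlab

open Literature.Probability.Percolation Literature.Probability.LatticeModels SimpleGraph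
open scoped Classical

variable {k : ℕ}

/-- **THE LEG LIFTING LEMMA, sharpened**: as «BccSlabLift».`exists_lift`, and when the planar leg has at least three columns the lift visits the LAST column
only at its end vertex (lift the leg without its last column to a neighbour of the end vertex over the last-but-one column, then step).
[cite: DuminilCopinSidoraviciusTassion2016, §2.3 (proof of Fact 2)] -/
theorem exists_lift' (hk : 1 ≤ k) {π : List (Site 2)} (hπ : π ≠ []) (hc : π.IsChain (fun a b => (zdGraph 2).Adj a b)) (hnd : π.Nodup)
    (hlen : 2 ≤ π.length) (v w : bslab k) (hv : sh v = π.head hπ) (hw : sh w = π.getLast hπ) :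
    ∃ L : List (bslab k), GPath (slabGraph k) L v w ∧ (∀ x ∈ L, sh x ∈ π) ∧ (3 ≤ π.length → ∀ x ∈ L, sh x = π.getLast hπ → x = w) := by
  by_cases h3 : 3 ≤ π.length
  · -- split off the last column
    set a := π.getLast hπ with ha
    set π' := π.dropLast with hπ'
    have hsplit : π = π' ++ [a] := (List.dropLast_append_getLast hπ).symm
    have hπ'ne : π' ≠ [] := by
      intro h; rw [h, List.nil_append] at hsplit; rw [hsplit] at h3; simp at h3
    have hlen' : 2 ≤ π'.length := by
      have : π'.length = π.length - 1 := by rw [hπ', List.length_dropLast]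
      omega
    have hc' : π'.IsChain (fun a b => (zdGraph 2).Adj a b) := by rw [hsplit, List.isChain_append] at hc; exact hc.1
    have hnd' : π'.Nodup := hnd.sublist (List.dropLast_sublist π)
    have haπ' : a ∉ π' := by
      intro h
      rw [hsplit] at hnd
      exact (List.nodup_append.1 hnd).2.2 a h a (List.mem_singleton_self a) rfl
    set p' := π'.getLast hπ'ne with hp'
    have hadj : (zdGraph 2).Adj p' a := by
      rw [hsplit, List.isChain_append] at hc
      exact hc.2.2 p' (by rw [List.getLast?_eq_getLast_of_ne_nil hπ'ne, hp']; exact Option.mem_some_iff.2 rfl) a (by simp)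
    have hhead : π'.head hπ'ne = π.head hπ := by
      obtain ⟨p, rest, hpr⟩ := List.exists_cons_of_ne_nil hπ
      subst hpr
      have hrest : rest ≠ [] := by intro h; subst h; simp at hlen
      simp only [hπ', List.dropLast_cons_of_ne_nil hrest, List.head_cons]
    -- the neighbour of `w` over `p'`
    obtain ⟨hw0, hwk, hwpar⟩ := adm_sh_ht w
    rw [hw] at hwpar
    set t : ℤ := if ht w + 1 ≤ k then ht w + 1 else ht w - 1 with ht'
    have htstep : t = ht w + 1 ∨ t = ht w - 1 := by rw [ht']; split_ifs <;> simp
    have hk' : (1 : ℤ) ≤ k := by exact_mod_cast hk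
    have htrange : 0 ≤ t ∧ t ≤ k := by rw [ht']; split_ifs <;> omega
    have hadm : Adm k p' t := by
      refine ⟨htrange.1, htrange.2, ?_⟩
      obtain ⟨m, hm⟩ := hwpar
      rcases sum_step_of_adj hadj with e | e <;> rcases htstep with e' | e'
      · exact ⟨m - 1, by omega⟩
      · exact ⟨m, by omega⟩
      · exact ⟨m, by omega⟩
      · exact ⟨m + 1, by omega⟩
    set v' : bslab k := vtx k p' t with hv'
    have hv'sh : sh v' = p' := sh_vtx hadm
    have hv'w : (slabGraph k).Adj v' w := by
      have := adj_vtx hadm (adm_sh_ht w) (by rw [hw]; exact hadj) (by rcases htstep with e | e <;> omega)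
      rwa [vtx_sh_ht] at this
    obtain ⟨L', hG', hcols'⟩ := exists_lift hk hπ'ne hc' hnd' hlen' v v' (by rw [hhead]; exact hv) (by rw [hv'sh])
    have hwL' : w ∉ L' := fun h => haπ' (by have := hcols' w h; rwa [hw] at this)
    refine ⟨L' ++ [w], ?_, ?_, ?_⟩
    · have := hG'.trans (GPath.pair hv'w) ?_
      · simpa using this
      · intro x hx hxL'
        simp only [List.mem_cons, List.not_mem_nil, or_false] at hx
        rcases hx with rfl | rfl
        · rfl
        · exact absurd hxL' hwL'
    · intro x hx
      rcases List.mem_append.1 hx with h | h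
      · rw [hsplit]; exact List.mem_append_left _ (hcols' x h)
      · rw [List.mem_singleton] at h; rw [h, hw]; exact List.getLast_mem hπ
    · intro _ x hx hxa
      rcases List.mem_append.1 hx with h | h
      · exact absurd (hxa ▸ hcols' x h) haπ'
      · exact List.mem_singleton.1 h
  · obtain ⟨L, hG, hcols⟩ := exists_lift hk hπ hc hnd hlen v w hv hw
    exact ⟨L, hG, hcols, fun h => absurd h h3⟩

/-! ## §3 From a planar claw to a swap pair of routings -/

open BccClawX

/-- The planar leg of the model, as columns of `Site 2`. [folklore] -/
theorem leg_site {R : Pt → Bool} {avoid : List Pt} {q a : Pt} {l : List Pt} (h : LegProps R avoid q a l) (z : Site 2) :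
    (l.map (pt z)) ≠ [] ∧ (l.map (pt z)).IsChain (fun a b => (zdGraph 2).Adj a b) ∧ (l.map (pt z)).Nodup ∧ 2 ≤ (l.map (pt z)).length ∧
      (∀ hne : l.map (pt z) ≠ [], (l.map (pt z)).head hne = pt z (l.head h.ne_nil) ∧ (l.map (pt z)).getLast hne = pt z a) ∧
      (∀ w ∈ l.map (pt z), R (rel z w) = true) ∧ pt z q ∉ l.map (pt z) ∧ (∀ x ∈ avoid, pt z x ∉ l.map (pt z)) ∧
      (zdGraph 2).Adj (pt z q) (pt z (l.head h.ne_nil)) := by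
  have hne : l.map (pt z) ≠ [] := by simpa using h.ne_nil
  refine ⟨hne, ?_, h.nodup.map (pt_injective z), by simpa using h.two_le, fun hne' => ⟨by rw [List.head_map], by rw [List.getLast_map, h.last]⟩,
    ?_, ?_, ?_, adjb_iff.1 h.head_adj⟩
  · rw [List.isChain_map]; exact h.chain.imp fun a b hab => adjb_iff.1 hab
  · intro w hw
    obtain ⟨p, hp, rfl⟩ := List.mem_map.1 hw
    rw [rel_pt]; exact h.mem_R p hp
  · intro hq
    obtain ⟨p, hp, hpq⟩ := List.mem_map.1 hq
    exact h.ne_q p hp (pt_injective z hpq)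
  · intro x hx hxl
    obtain ⟨p, hp, hpx⟩ := List.mem_map.1 hxl
    rw [pt_injective z hpx] at hp
    exact h.not_avoid x hp hx

/-- Parity bookkeeping: over a column adjacent to `Q`, the height `h₀ + 1` is admissible when `(Q, h₀)` is and `h₀ + 1 ≤ k`. [folklore] -/
theorem adm_port {Q P : Site 2} {h₀ : ℤ} (hQ : Adm k Q h₀) (hadj : (zdGraph 2).Adj Q P) (hk : h₀ + 1 ≤ k) : Adm k P (h₀ + 1) := by
  obtain ⟨h0, -, ⟨m, hm⟩⟩ := hQ
  refine ⟨by omega, hk, ?_⟩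
  rcases sum_step_of_adj hadj with e | e
  · exact ⟨m, by omega⟩
  · exact ⟨m - 1, by omega⟩

/-- **FROM A PLANAR CLAW TO A SWAP PAIR** (`k ≥ 3`): hub vertices `y = (Q, h₀)`, `b = (Q, h₀ + 2)` over the hub column `Q` (`h₀ ∈ {0,1}` by parity), ports
`c, m, n` at height `h₀ + 1` over the first columns of the legs, the three legs lifted by `exists_lift'` to self-avoiding slab paths ending at `E₁, E₂, w'`;
column-disjointness of the legs gives vertex-disjointness, the regions give the cleared-set conditions.
[cite: DuminilCopinSidoraviciusTassion2016, §2.3 (proof of Fact 2: the three disjoint paths in B̄_R(z))] -/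
theorem swapPair_of_clawProps (hk : 3 ≤ k) {z : Site 2} {tR tD sR sD : ℕ} {E₁ E₂ w' : bslab k} (hne : E₁ ≠ E₂) {q : Pt} {l1 l2 l3 : List Pt}
    (hP : ClawProps (min tR 3) (min tD 4) (min sR 3) (min sD 4) (rel z (sh E₁)) (rel z (sh E₂)) (rel z (sh w')) q l1 l2 l3) :
    ∃ r₁ r₂ : VRouteData (slabGraph k) (clearedSet k z tD sD ∩ (sqShadow k).lift (sqBlkR 3 z tR sR)) (clearedSet k z tD sD) E₁ E₂ w',
      r₁.y = r₂.b ∧ r₁.b = r₂.y := by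
  have hk1 : 1 ≤ k := le_trans (by norm_num) hk
  have hk' : (3 : ℤ) ≤ k := by exact_mod_cast hk
  -- the hub column and its two vertices
  obtain ⟨Q, hQ⟩ : ∃ Q : Site 2, Q = pt z q := ⟨_, rfl⟩
  set h₀ : ℤ := (Q 0 + Q 1) % 2 with hh₀
  have hh₀r : 0 ≤ h₀ ∧ h₀ ≤ 1 := ⟨Int.emod_nonneg _ two_ne_zero, by have := Int.emod_lt_of_pos (Q 0 + Q 1) two_pos; omega⟩
  have hh₀e : Even (Q 0 + Q 1 - h₀) := ⟨(Q 0 + Q 1) / 2, by rw [hh₀]; omega⟩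
  have hAy : Adm k Q h₀ := ⟨hh₀r.1, by omega, hh₀e⟩
  have hAb : Adm k Q (h₀ + 2) := ⟨by omega, by omega, by obtain ⟨m, hm⟩ := hh₀e; exact ⟨m - 1, by omega⟩⟩
  set y : bslab k := vtx k Q h₀ with hy
  set b : bslab k := vtx k Q (h₀ + 2) with hb
  have hysh : sh y = Q := sh_vtx hAy
  have hbsh : sh b = Q := sh_vtx hAb
  have hyb : y ≠ b := by
    intro e; have := (vtx_eq_vtx_iff hAy hAb).1 e; omega
  -- the legs as columns of `Site 2`
  obtain ⟨hne1, hc1, hnd1, hlen1, hends1, hR1, hq1, -, hadj1⟩ := leg_site hP.leg1 z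
  obtain ⟨hne2, hc2, hnd2, hlen2, hends2, hR2, hq2, -, hadj2⟩ := leg_site hP.leg2 z
  obtain ⟨hne3, hc3, hnd3, hlen3, hends3, hR3, hq3, -, hadj3⟩ := leg_site hP.leg3 z
  rw [← hQ] at hq1 hq2 hq3 hadj1 hadj2 hadj3
  obtain ⟨hhead1, hlast1⟩ := hends1 hne1
  obtain ⟨hhead2, hlast2⟩ := hends2 hne2
  obtain ⟨hhead3, hlast3⟩ := hends3 hne3
  rw [pt_rel] at hlast1 hlast2 hlast3
  -- the ports
  set P₁ : Site 2 := pt z (l1.head hP.leg1.ne_nil) with hP₁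
  set P₂ : Site 2 := pt z (l2.head hP.leg2.ne_nil) with hP₂
  set P₃ : Site 2 := pt z (l3.head hP.leg3.ne_nil) with hP₃
  have hA1 : Adm k P₁ (h₀ + 1) := adm_port hAy hadj1 (by omega)
  have hA2 : Adm k P₂ (h₀ + 1) := adm_port hAy hadj2 (by omega)
  have hA3 : Adm k P₃ (h₀ + 1) := adm_port hAy hadj3 (by omega)
  set c : bslab k := vtx k P₁ (h₀ + 1) with hc
  set m : bslab k := vtx k P₂ (h₀ + 1) with hm
  set n : bslab k := vtx k P₃ (h₀ + 1) with hn
  have hcy : (slabGraph k).Adj c y := adj_vtx hA1 hAy hadj1.symm (Or.inr (by ring))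
  have hcb : (slabGraph k).Adj c b := adj_vtx hA1 hAb hadj1.symm (Or.inl (by ring))
  have hym : (slabGraph k).Adj y m := adj_vtx hAy hA2 hadj2 (Or.inl rfl)
  have hbm : (slabGraph k).Adj b m := adj_vtx hAb hA2 hadj2 (Or.inr (by ring))
  have hyn : (slabGraph k).Adj y n := adj_vtx hAy hA3 hadj3 (Or.inl rfl)
  have hbn : (slabGraph k).Adj b n := adj_vtx hAb hA3 hadj3 (Or.inr (by ring))
  -- the lifts
  obtain ⟨LA, hGA, hcolA, honceA⟩ := exists_lift' hk1 hne1 hc1 hnd1 hlen1 c E₁ (by rw [hhead1]; exact sh_vtx hA1) (by rw [hlast1])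
  obtain ⟨LB, hGB, hcolB, honceB⟩ := exists_lift' hk1 hne2 hc2 hnd2 hlen2 m E₂ (by rw [hhead2]; exact sh_vtx hA2) (by rw [hlast2])
  obtain ⟨LC, hGC, hcolC, -⟩ := exists_lift' hk1 hne3 hc3 hnd3 hlen3 n w' (by rw [hhead3]; exact sh_vtx hA3) (by rw [hlast3])
  -- cleared-set conditions
  have hWR : ∀ x : bslab k, inRPp (min tR 3) (min tD 4) (min sR 3) (min sD 4) (rel z (sh x)) = true →
      x ∈ clearedSet k z tD sD ∩ (sqShadow k).lift (sqBlkR 3 z tR sR) := by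
    intro x hx
    obtain ⟨hD, hRb⟩ := inRPp_rel_iff.1 hx
    exact ⟨hD, by rw [SqShadow.mem_lift, sqShadow_sh]; exact hRb⟩
  have hAW : ∀ x ∈ LA, x ∈ clearedSet k z tD sD ∩ (sqShadow k).lift (sqBlkR 3 z tR sR) := fun x hx => hWR x (hR1 _ (hcolA x hx))
  have hBW : ∀ x ∈ LB, x ∈ clearedSet k z tD sD ∩ (sqShadow k).lift (sqBlkR 3 z tR sR) := fun x hx => hWR x (hR2 _ (hcolB x hx))
  have hCW : ∀ x ∈ LC, x ∈ clearedSet k z tD sD := fun x hx => inDp_rel_iff.1 (hR3 _ (hcolC x hx))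
  have hqW : inRPp (min tR 3) (min tD 4) (min sR 3) (min sD 4) (rel z Q) = true := by rw [hQ, rel_pt]; exact hP.hq
  have hyW := hWR y (by rw [hysh]; exact hqW)
  have hbW := hWR b (by rw [hbsh]; exact hqW)
  -- disjointness
  have hyA : y ∉ LA := fun h => hq1 (hysh ▸ hcolA y h)
  have hyB : y ∉ LB := fun h => hq2 (hysh ▸ hcolB y h)
  have hyC : y ∉ LC := fun h => hq3 (hysh ▸ hcolC y h)
  have hbA : b ∉ LA := fun h => hq1 (hbsh ▸ hcolA b h)
  have hbB : b ∉ LB := fun h => hq2 (hbsh ▸ hcolB b h)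
  have hbC : b ∉ LC := fun h => hq3 (hbsh ▸ hcolC b h)
  have hAB : ∀ x ∈ LA, x ∉ LB := by
    intro x hxA hxB
    have h1 := hcolA x hxA
    have h2 := hcolB x hxB
    obtain ⟨p, hp, hpx⟩ := List.mem_map.1 h1
    obtain ⟨p', hp', hp'x⟩ := List.mem_map.1 h2
    have hpp : p = p' := pt_injective z (hpx.trans hp'x.symm)
    obtain ⟨heq, hpa⟩ := hP.d12 p hp (hpp ▸ hp')
    -- both legs end in the shared column, visited only at `E₁`, `E₂`
    have hl1 : 3 ≤ (l1.map (pt z)).length := by simpa using hP.len1 heq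
    have hl2 : 3 ≤ (l2.map (pt z)).length := by simpa using hP.len2 heq
    have hx1 : x = E₁ := honceA hl1 x hxA (by rw [hlast1, ← hpx, hpa, pt_rel])
    have hx2 : x = E₂ := honceB hl2 x hxB (by rw [hlast2, ← hp'x, ← hpp, hpa, heq, pt_rel])
    exact hne (hx1.symm.trans hx2)
  have hAC : ∀ x ∈ LA, x ∉ LC := by
    intro x hxA hxC
    obtain ⟨p, hp, hpx⟩ := List.mem_map.1 (hcolC x hxC)
    exact hP.d31 p hp (by have := hcolA x hxA; rw [← hpx] at this; obtain ⟨p', hp', e⟩ := List.mem_map.1 this; rwa [← pt_injective z e])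
  have hBC : ∀ x ∈ LB, x ∉ LC := by
    intro x hxB hxC
    obtain ⟨p, hp, hpx⟩ := List.mem_map.1 (hcolC x hxC)
    exact hP.d32 p hp (by have := hcolB x hxB; rw [← hpx] at this; obtain ⟨p', hp', e⟩ := List.mem_map.1 this; rwa [← pt_injective z e])
  exact VRouteData.swapPair_of_hub hGA hGB hGC hne hAW hBW hCW hyW hbW (fun x hx => hx.1) hcy hcb hym hbm hyn hbn hyb hAB hAC hBC
    hyA hyB hyC hbA hbB hbC

end BccSlab

end Summit.CriticalPhenomena.PercolationContinuityZ3.Theorems.Transplant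

end
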